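import Summits.CriticalPhenomena.PercolationContinuityZ3.Theses.PercNonProliferation
import Summits.CriticalPhenomena.PercolationContinuityZ3.Theorems.SubpolynomialBlocking.Negative.OffCritical
import Summits.CriticalPhenomena.PercolationContinuityZ3.Theorems.SubpolynomialBlocking.Negative.Strengthenings
import Literature.Probability.Percolation.BondPercolationSymmetry
import Literature.Probability.Percolation.SiteConnectionTools
import Literature.Probability.Percolation.InequalitiesProofs
import Literature.Probability.Percolation.HalfSpace

/-!
# Line `root-trick-wall-patch` for the crux `SubpolynomialBlocking` (stmt-CriticalPhenomena-4446)

Skeleton (crux-plan, round 1) of the idea card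
`Cruxes/SubpolynomialBlocking/Ideas/root-trick-wall-patch.md` (ideator 3; triage r1: fail / fail / pass —
all three triagers certify the lever and the equivalence, and kill the card's engines E1/E2; see the line card).

THE CRUX. `u_n := P_{p_c(ℤ³)}(Λ_n ↮ ∂ⁱⁿΛ_{2n} inside Λ_{2n})` (`u`, `blockEvt`; `u n` is literally the probability in
`PercNonProliferation.SubpolynomialBlocking` and equals the disprover's `Negative.blockProb 3 p_c n`, `u_eq_blockProb`);
the crux is `∀ s > 0, ∀ᶠ n, n^{-s} ≤ u_n`.

THE LINE (root trick, applied DIRECTLY to the annulus — a sharpening of the card's (R1), which went through the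
flat box `F_r` and the cross-sandwich). Let `HS(r) :=` "no open path inside the half-space ball
`H ∩ B⁺(P_r, 4r) = [0,4r] × [-4r, 5r-1]²` from the wall patch `P_r = {0} × [0,r)²` to sup-distance `4r`"
(`hsEvt r`, probability `h r`). For `n ≥ 10` put `r := ⌊n/5⌋` (`cellScale n`, so `4r < n`) and cover the six faces of
`∂ⁱⁿΛ_{2n}` by `K = 6·32²` wall cells: isometric copies `ψ_c(P_r)` of the patch, `ψ_c = shift ∘ signed permutation ∘ shift`
(`cellIso n c`) placing the standard half-space ball INSIDE the slab `{2n - 4r ≤ ±y_i ≤ 2n}` with its wall on the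
face. ROOT TRICK (= last entrance): an open lattice path inside `Λ_{2n}` from `Λ_n` to a point of the cell `ψ_c(P_r)`
starts outside `ψ_c(H ∩ B⁺)` (because `4r < n`) and therefore ENTERS it across `ψ_c(farFace r)`; its final segment is
an open path inside `ψ_c(H ∩ B⁺)` from `ψ_c(farFace r)` to `ψ_c(P_r)`. Hence
  `blockEvt n ⊇ ⋂_c shieldAt ψ_c r`  (STUB 1, deterministic, lattice configurations),
the `K` shield events are decreasing, each of probability `h r` (lattice symmetry), so Harris–FKG gives
  `u_n ≥ h(⌊n/5⌋)^K`  (STUB 2),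
and the crux follows from the TRANSFER TARGET
  `C⁺ = WallPatchEnclosureSubpoly : ∀ s > 0, ∀ᶠ r, r^{-s} ≤ h r`  (STUB 3, OPEN, load-bearing)
by real analysis — PROVED here (`subpolynomialBlockingAt_of`, `SubpolynomialBlocking_of`, which concludes
`Summit.CriticalPhenomena.PercolationContinuityZ3.Theses.PercNonProliferation.SubpolynomialBlocking` BY NAME).
`C⁺` is EQUIVALENT to the crux up to fixed powers (converse: `hsEvt r ⊇` five far-face flat seals, each `≥` a power of
`u` at scale `≍ r` by the six-column sandwich of card cross-sandwich-flat-seal; not needed here, not stated), so STUB 3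
is not a strengthening: it is the crux moved to the WALL, where for FIXED `r` the enclosure probability tends to `1` as the
radius grows (Barsky–Grimmett–Newman `θ_H(p_c) = 0`, named fact `BarskyGrimmettNewman1991_Z3`), the source is the
least-clustered one (first-moment deficit `r^{2-x_s} ≈ r^{1.03}` instead of `r^{2.52}`), and depth is a free monotone
parameter. No engine for STUB 3 is claimed (triage: E1 dead by arithmetic, E2 of `X_B` strength).

DISPROOF USED (`Cruxes/SubpolynomialBlocking/Disproof.lean`, cdisprove cycle 1; Negative lane LANDED and IMPORTED here:
`Theorems/SubpolynomialBlocking/Negative/{OffCritical,Strengthenings}.lean`). §2 `not_subpolynomialBlockingAt_of_criticalProb_lt`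
(a proof must use `p ≤ p_c`) and §4 `not_subpolynomialBlockingAt_criticalProb_above_six` (a proof must use `d ≤ 6`): BOTH
honoured at STUB 3 — STUBS 1–2 are deterministic / Harris + symmetry, valid for every `p` and every `d`, so by the proved
composition `C⁺` is false for `p > p_c` (`h ≤ u^{1/K} ≤ e^{-γn/K}`) and in `d ≥ 7` under `η = 0` (`h ≤ (K'/n)^{1/K}`),
exactly like the crux; the `p ≤ p_c` and `d = 3` inputs must enter the proof of STUB 3 and nowhere else. §6 refuted
strengthenings (`not_uniform_in_s`, `not_exponent_zero`, `not_forall_n`): avoided — `C⁺` keeps the crux's quantifier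
shape `∀ s > 0, ∀ᶠ r`; no `s = 0`, no `∀ r ≥ 1` form (indeed `h r < 1` for `r ≥ 1`: a straight wall-normal arm). §7 floor:
the card's Harris floor `h(r) ≥ (1 - π_H(3r))^{r²} = e^{-O(r^{1.03})}` is the wall analogue of
`pow_card_edgeBoundary_le_blockProb` and is NOT registered as a stub (dead line D6). No stub is an instance of a landed
Negative lemma (readback `example`s at the end of the file).
-/

noncomputable section

namespace Summit.CriticalPhenomena.PercolationContinuityZ3.Cruxes.SubpolynomialBlocking.RootTrickWallPatch

open MeasureTheory Filter Topology
open Literature.Probability.Percolation Literature.Probability.LatticeModels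
open Summit.CriticalPhenomena.PercolationContinuityZ3.Theorems.SubpolynomialBlocking

/-! ## Objects of the line -/

/-- The critical bond percolation measure on `ℤ³`. -/
abbrev μc : Measure (BondConfig (Site 3)) := bondPercolation (zdGraph 3) (criticalProbI 3)

/-- Coordinate box `{x | ∀ i, a i ≤ x i ≤ b i}`. -/
def cbox (a b : Site 3) : Set (Site 3) := {x | ∀ i, a i ≤ x i ∧ x i ≤ b i}

/-- The crux's event: the annulus `Λ_{2n} ∖ Λ_n` is BLOCKED (no open path inside `Λ_{2n}` from `Λ_n` to
`∂ⁱⁿΛ_{2n}`). Verbatim the set appearing in `SubpolynomialBlocking`. -/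
def blockEvt (n : ℕ) : Set (BondConfig (Site 3)) :=
  {ω | ¬ ∃ x ∈ box 3 n, ∃ y ∈ innerBoundary (zdGraph 3) (box 3 (2 * n)),
      ω ∈ openConnIn (↑(box 3 (2 * n)) : Set (Site 3)) x y}

/-- `u n := P_{p_c}(blockEvt n)`, the critical annulus-blocking probability. -/
def u (n : ℕ) : ℝ := μc.real (blockEvt n)

/-- The wall patch `P_r = {0} × [0,r)²` on the wall `{x₀ = 0}` of the half-space `H = {0 ≤ x₀}`. -/
def patch (r : ℕ) : Set (Site 3) := {x | x 0 = 0 ∧ 0 ≤ x 1 ∧ x 1 < r ∧ 0 ≤ x 2 ∧ x 2 < r}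

/-- `H ∩ B⁺(P_r, 4r) = [0,4r] × [-4r, 5r-1]²`: the points of the half-space at sup-distance `≤ 4r` from the patch. -/
def hsBall (r : ℕ) : Set (Site 3) :=
  cbox ![0, -(4 * (r : ℤ)), -(4 * (r : ℤ))] ![4 * (r : ℤ), 5 * (r : ℤ) - 1, 5 * (r : ℤ) - 1]

/-- The far boundary `H ∩ S(P_r, 4r)`: points of `hsBall r` at sup-distance exactly `4r` from the patch
(depth `4r`, or lateral offset `4r`). -/
def farFace (r : ℕ) : Set (Site 3) :=
  {y | y ∈ hsBall r ∧ (y 0 = 4 * (r : ℤ) ∨ y 1 = -(4 * (r : ℤ)) ∨ y 1 = 5 * (r : ℤ) - 1 ∨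
      y 2 = -(4 * (r : ℤ)) ∨ y 2 = 5 * (r : ℤ) - 1)}

/-- HALF-SPACE PATCH ENCLOSURE `HS(r) = HS(r,4r)`: no open path inside `H ∩ B⁺(P_r, 4r)` joins the wall patch
`P_r` to sup-distance `4r`. Decreasing event. (Card `root-trick-wall-patch`, `hsEvt` of SketchIdeator3, verbatim.) -/
def hsEvt (r : ℕ) : Set (BondConfig (Site 3)) :=
  {ω | ¬ ∃ x ∈ patch r, ∃ y ∈ farFace r, ω ∈ openConnIn (hsBall r) x y}

/-- `h r := P_{p_c}(HS(r))`. -/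
def h (r : ℕ) : ℝ := μc.real (hsEvt r)

/-- The TRANSFER TARGET `C⁺` (mesoscopic Barsky–Grimmett–Newman): the critical wall-patch enclosure probability
decays slower than any power of the patch side. -/
def WallPatchEnclosureSubpoly : Prop := ∀ s : ℝ, 0 < s → ∀ᶠ r : ℕ in atTop, (r : ℝ) ^ (-s) ≤ h r

/-! ### Cells: isometric copies of the half-space ball hung on the faces of `Λ_{2n}` -/

/-- Cell index: face direction `i`, side `τ` (the wall of the cell lies on the face `{y_i = -τ·2n}`, its depth
points inwards), lateral offsets `k₁, k₂` (patch corner at lateral coordinates `-2n + k·r`). With `r = ⌊n/5⌋` and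
`n ≥ 10` the `32 × 32` offsets cover each `(4n+1) × (4n+1)` face (`⌊4n/r⌋ ≤ 28`). -/
abbrev Cell : Type := Fin 3 × ℤˣ × Fin 32 × Fin 32

/-- The patch scale used at annulus scale `n`: `r(n) = ⌊n/5⌋`, so that `4 r(n) < n` for `n ≥ 1`. -/
def cellScale (n : ℕ) : ℕ := n / 5

/-- Lateral placement (in standard coordinates): patch corner moved to `(0, -2n + k₁ r, -2n + k₂ r)`. -/
def latOffset (n : ℕ) (c : Cell) : Site 3 :=
  ![0, -(2 * (n : ℤ)) + (c.2.2.1 : ℕ) * (cellScale n : ℤ), -(2 * (n : ℤ)) + (c.2.2.2 : ℕ) * (cellScale n : ℤ)]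

/-- Orientation: coordinate `0` (depth) goes to the face direction `i`, with sign `τ` there and `+1` laterally. -/
def cellSign (c : Cell) : Fin 3 → ℤˣ := Function.update 1 c.1 c.2.1

/-- Final shift putting the wall on the face `{y_i = -τ·2n}`. -/
def faceShift (n : ℕ) (c : Cell) : Site 3 := Pi.single c.1 (-(c.2.1 : ℤ) * (2 * (n : ℤ)))

/-- The lattice isometry `ψ_c` of cell `c` (standard picture → physical position): `x ↦ σ_c (x + w_c) + v_c` with
`σ_c` the signed coordinate permutation `swap 0 i` / `cellSign`, so that depth `x₀ = t` lands at `y_i = τ (t - 2n)`,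
i.e. at distance `t` INSIDE `Λ_{2n}` from the face `{y_i = -τ·2n}`. A graph automorphism of `ℤ³`, hence
`P_{p}`-preserving (`bondPercolation_real_preimage_relabel_iso`). -/
def cellIso (n : ℕ) (c : Cell) : zdGraph 3 ≃g zdGraph 3 :=
  (zdShiftIso (latOffset n c)).trans
    ((zdSignedPermIso (Equiv.swap 0 c.1) (cellSign c)).trans (zdShiftIso (faceShift n c)))

/-- The enclosure event transported by a bijection `e` of `ℤ³`: no open path inside `e '' hsBall r` from
`e '' patch r` to `e '' farFace r`. For a lattice automorphism `e` this is the preimage of `hsEvt r` under relabelling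
by `e⁻¹`, hence has probability `h r`. -/
def shieldAt (e : Site 3 ≃ Site 3) (r : ℕ) : Set (BondConfig (Site 3)) :=
  {ω | ¬ ∃ x ∈ e '' patch r, ∃ y ∈ e '' farFace r, ω ∈ openConnIn (e '' hsBall r) x y}

/-- The shield event of cell `c` at annulus scale `n`. -/
def cellShield (n : ℕ) (c : Cell) : Set (BondConfig (Site 3)) := shieldAt (cellIso n c).toEquiv (cellScale n)

/-! ## The three stub statements -/

/-- STUB 1 statement (ROOT TRICK = covering + last entrance; deterministic, lattice configurations): if every wall
cell of `∂ⁱⁿΛ_{2n}` is shielded then the annulus is blocked. -/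
def ShieldCover : Prop :=
  ∀ n : ℕ, 10 ≤ n → ∀ ω : BondConfig (Site 3), ω ⊆ (zdGraph 3).edgeSet →
    (∀ c : Cell, ω ∈ cellShield n c) → ω ∈ blockEvt n

/-- STUB 2 statement (Harris–FKG for the `K = |Cell|` decreasing shield events + lattice symmetry
`P(cellShield n c) = h ⌊n/5⌋`). -/
def HarrisShields : Prop :=
  ∀ n : ℕ, 10 ≤ n → h (cellScale n) ^ Fintype.card Cell ≤ μc.real (⋂ c : Cell, cellShield n c)

/-! ## Registered stubs -/

/-- **STUB 1 `shieldCover`** (M, PROVABLE NOW). Let `n ≥ 10`, `r = ⌊n/5⌋ ≥ 2`, `ω ⊆ E(ℤ³)`, and suppose an open path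
`γ` inside `Λ_{2n}` runs from `x ∈ Λ_n` to `y ∈ ∂ⁱⁿΛ_{2n}`. (a) COVERING: `y_i = ∓2n` for some `i`
(`exists_eq_of_mem_innerBoundary_box`); with `τ := ±1` accordingly and `k_j := ⌊(y_{π j} + 2n)/r⌋ ≤ ⌊4n/r⌋ ≤ 28 < 32`
(`π = swap 0 i`), `y ∈ ψ_c(patch r)` for `c = (i, τ, k₁, k₂)`. (b) LAST ENTRANCE: `ψ_c(hsBall r) ⊆ {2n - 4r ≤ -τ y_i ≤ 2n}`
and `-τ x_i ≤ n < 2n - 4r` (`4r ≤ 4n/5 < n`), so `γ` starts outside `ψ_c(hsBall r)` and ends inside; let `z` be the first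
vertex after the last vertex of `γ` outside it. Its predecessor is a lattice neighbour in `Λ_{2n} ∖ ψ_c(hsBall r)`;
in standard coordinates (`ψ_c⁻¹`, an automorphism of `ℤ³`; `ψ_c⁻¹(Λ_{2n}) ⊆ {0 ≤ x₀}`) the violated constraint is
`x₀ ≤ 4r` or a lateral one, whence `z ∈ ψ_c(farFace r)`. (c) The final segment of `γ` reversed is an open path inside
`ψ_c(hsBall r)` from `y ∈ ψ_c(patch r)` to `z ∈ ψ_c(farFace r)`: `ω ∉ cellShield n c`. Tools: `mem_openConnIn_iff_pathIn`
/ `SimpleGraph.Walk` last-exit (`pathIn.exit` pattern of `Negative.not_mem_annulusCrossing_of_forall_notMem`),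
`Site.signedPerm_apply`, `zdShiftIso_apply`, `mem_box`. [card First lemma (R1), triage r1-1/2/3: inclusion checked] -/
theorem stub_shieldCover : ShieldCover := by
  sorry

/-- **STUB 2 `harrisShields`** (M, PROVABLE NOW). (i) SYMMETRY: for the automorphism `ψ = cellIso n c`,
`shieldAt ψ r = (BondConfig.relabel (sym2Equiv ψ.symm.toEquiv)) ⁻¹' (hsEvt r)` (`openGraph_relabel_adj_iff`: an
`ψ⁻¹ω`-open path inside `hsBall` is the `ψ⁻¹`-image of an `ω`-open path inside `ψ(hsBall)`; cf. `real_bconn_iso` in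
`BondTwoPointLowerBound.lean`), so `μc.real (cellShield n c) = h r` by `bondPercolation_real_preimage_relabel_iso ψ.symm`.
(ii) Each `cellShield n c` is a lower set (closing edges kills paths) and measurable (complement of a finite union of
`openConnIn` events over finite sets, `measurableSet_openConnIn(_of_countable)`). (iii) HARRIS–FKG for finitely many
decreasing events, `∏_c P(A_c) ≤ P(⋂_c A_c)`: induction on `Finset.univ : Finset Cell` with `harris_fkg_lower`
(the increasing form is `real_biInter_ge_prod`). [card: Harris step of (R1); Grimmett 1999 Thm 2.4] -/
theorem stub_harrisShields : HarrisShields := by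
  sorry

/-- **STUB 3 `wallPatchEnclosure`** (XL, OPEN — THE LOAD-BEARING STUB, the lead's): the transfer target `C⁺`,
`∀ s > 0, ∀ᶠ r, r^{-s} ≤ h r` — "a wall patch of side `r` is walled off inside the half-space within distance `4r` with
probability `≥ r^{-o(1)}`", Barsky–Grimmett–Newman made uniform at aspect ratio `4`. EQUIVALENT to the crux up to fixed
powers (this file proves `⇐`; `⇒` is the five-far-face-seals + six-column sandwich of the card, not needed). Numerically
`h(r) → h* ∈ (0,1)` is predicted (hyperscaling); MEASURED by this seat's kit job j010925 (summary auto-attached to the item),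
`r = 2, 3, 4, 6, 8, 11, 16`: `h(2) = 0.696`, `h(3) = 0.695`, `h(4) = 0.672`, `h(6) = 0.684`, `h(8) = 0.681`, `h(11) = 0.685`, `h(16) = 0.689` (s.e. ≤ 0.013; samples 4000/4000/4000/4000/4000/4000/1345) —
a FLAT PLATEAU `h ≈ 0.68`, with wall one-arm to `4r` = 0.157, 0.108, 0.087, 0.057, 0.036, 0.033, 0.024 (slope ≈ `-x_s`) and
`E[#escaping patch points]` = 0.62, 0.94, 1.40, 1.97, 2.81, 3.71, 5.03 (`≈ r^{2-x_s}`, the card's first-moment count). WHY IT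
MIGHT FAIL / WHAT A PROOF MUST USE: false for every `p > p_c` and in `d ≥ 7` under `η = 0` (Disproof §2/§4 transported by
STUBS 1–2), so the proof must use `p ≤ p_c(ℤ³)` and a `d ≤ 6` input; the card's engines do not supply it (E1: the lateral
term forces slab thickness `εr` with `ε ≲ 1/log r`, and then "no dive to depth `r/log r`" is super-polynomially rare;
E2: wall-IIC size-biasing yields `h ≥ c`, i.e. `X_B` strength, from two open inputs). What the wall offers that the bulk
does not: BGN (`θ_H(p_c) = 0`, so `h(r, R) ↑ 1` as `R → ∞` for fixed `r`), the subcritical boundary slab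
(`p_c(ℤ³) < p_c(S_k)`), depth as a monotone parameter (`hsEvt` within `{x₀ ≤ D}` decreases to `HS(r)` as `D ↑ 4r`), and
wall exponents (`x_s ≈ 0.975`: first-moment deficit `r^{1.03}`). -/
theorem stub_wallPatchEnclosure : WallPatchEnclosureSubpoly := by
  sorry

/-! ### Name-keyed aliases of the stub statements (hypotheses of the composition) -/
namespace Registered

/-- Alias of `ShieldCover` keyed by the registered stub name. -/
abbrev stub_shieldCover : Prop := ShieldCover
/-- Alias of `HarrisShields` keyed by the registered stub name. -/
abbrev stub_harrisShields : Prop := HarrisShields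
/-- Alias of `WallPatchEnclosureSubpoly` keyed by the registered stub name. -/
abbrev stub_wallPatchEnclosure : Prop := WallPatchEnclosureSubpoly

end Registered

/-! ## Proved plumbing -/

/-- `u n` IS the disprover's blocking probability `blockProb 3 p_c n` (readback against the landed Negative lane). -/
theorem u_eq_blockProb (n : ℕ) : u n = Negative.blockProb 3 (criticalProbI 3) n := rfl

/-- The crux, restated through `u` (definitionally the route decl, via the landed `Negative.crux_iff`). -/
theorem subpolynomialBlockingAt_iff_u :
    Negative.SubpolynomialBlockingAt 3 (criticalProbI 3) ↔
      ∀ s : ℝ, 0 < s → ∀ᶠ n : ℕ in atTop, (n : ℝ) ^ (-s) ≤ u n :=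
  Iff.rfl

theorem h_nonneg (r : ℕ) : 0 ≤ h r := measureReal_nonneg

theorem h_le_one (r : ℕ) : h r ≤ 1 := measureReal_le_one

theorem u_le_one (n : ℕ) : u n ≤ 1 := measureReal_le_one

/-- No junk at `p_c`: `0 < u n < 1` for `n ≥ 1` (landed: surface-order floor and the straight critical arm). -/
theorem u_pos_lt_one {n : ℕ} (hn : 1 ≤ n) : 0 < u n ∧ u n < 1 :=
  ⟨Negative.blockProb_criticalProb_three_pos hn, Negative.blockProb_criticalProb_three_lt_one n⟩

/-- The empty patch is trivially enclosed: `h 0 = 1` (so `C⁺` is about `r → ∞` only). -/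
theorem hsEvt_zero : hsEvt 0 = Set.univ := by
  ext ω
  simp only [hsEvt, patch, Set.mem_setOf_eq, Set.mem_univ, iff_true, not_exists, not_and]
  intro x hx
  have h1 := hx.2.1
  have h2 := hx.2.2.1
  push_cast at h2
  omega

/-- `4 r(n) < n` for `n ≥ 1` (the standing geometric hypothesis of the root trick) and `r(n) ≥ 2` for `n ≥ 10`. -/
theorem cellScale_bounds {n : ℕ} (hn : 10 ≤ n) : 2 ≤ cellScale n ∧ 4 * cellScale n < n ∧ cellScale n ≤ n := by
  refine ⟨?_, ?_, Nat.div_le_self n 5⟩ <;> (unfold cellScale; omega)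

/-- `r(n) → ∞`. -/
theorem tendsto_cellScale : Tendsto cellScale atTop atTop := by
  refine tendsto_atTop_atTop.2 fun b => ⟨5 * b, fun n hn => ?_⟩
  unfold cellScale
  omega

/-- The number of cells is positive (used to split the exponent `s = K · (s/K)`). -/
theorem card_cell_pos : 0 < Fintype.card Cell := Fintype.card_pos

/-! ## Composition, part 1: STUBS 1 + 2 ⟹ `u_n ≥ h(⌊n/5⌋)^K` -/

/-- Root trick + Harris: `h(⌊n/5⌋)^K ≤ u_n` for `n ≥ 10` (the measure is supported on lattice configurations,
`real_mono_of_forall_subset_edgeSet`, so the deterministic STUB 1 transfers to probabilities). -/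
theorem pow_h_le_u (hcov : ShieldCover) (hhar : HarrisShields) {n : ℕ} (hn : 10 ≤ n) :
    h (cellScale n) ^ Fintype.card Cell ≤ u n := by
  refine (hhar n hn).trans ?_
  exact DCT16.real_mono_of_forall_subset_edgeSet (zdGraph 3) (criticalProbI 3)
    fun ω hω hmem => hcov n hn ω hω fun c => Set.mem_iInter.1 hmem c

/-! ## Composition, part 2: + STUB 3 ⟹ the crux -/

/-- **`C⁺` ⟹ crux** (given the front end): with `K = |Cell|` and `r = ⌊n/5⌋ → ∞`,
`n^{-s} ≤ r^{-s} = (r^{-s/K})^K ≤ h(r)^K ≤ u_n` eventually. The conclusion is written as the disprover's readback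
`Negative.SubpolynomialBlockingAt 3 p_c` (= the crux by `Negative.crux_iff`, `Iff.rfl`) so that
`SubpolynomialBlocking_of` below is the ONLY theorem of the file concluding the crux decl by name. -/
theorem subpolynomialBlockingAt_of (hcov : ShieldCover) (hhar : HarrisShields)
    (hwall : WallPatchEnclosureSubpoly) : Negative.SubpolynomialBlockingAt 3 (criticalProbI 3) := by
  rw [subpolynomialBlockingAt_iff_u]
  intro s hs
  set K : ℕ := Fintype.card Cell with hK
  have hK0 : 0 < K := card_cell_pos
  have hKr : (0 : ℝ) < K := by exact_mod_cast hK0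
  have hw : ∀ᶠ r : ℕ in atTop, (r : ℝ) ^ (-(s / K)) ≤ h r := hwall (s / K) (div_pos hs hKr)
  have hev : ∀ᶠ n : ℕ in atTop, ((cellScale n : ℕ) : ℝ) ^ (-(s / K)) ≤ h (cellScale n) :=
    tendsto_cellScale.eventually hw
  filter_upwards [hev, eventually_ge_atTop 10] with n hn h10
  obtain ⟨hr2, -, hrn⟩ := cellScale_bounds h10
  have hr0 : (0 : ℝ) < (cellScale n : ℝ) := by exact_mod_cast (lt_of_lt_of_le (by norm_num) hr2)
  have hrn' : ((cellScale n : ℕ) : ℝ) ≤ (n : ℝ) := by exact_mod_cast hrn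
  have hpow_nonneg : 0 ≤ ((cellScale n : ℕ) : ℝ) ^ (-(s / K)) := Real.rpow_nonneg hr0.le _
  have hsplit : ((cellScale n : ℕ) : ℝ) ^ (-s) = (((cellScale n : ℕ) : ℝ) ^ (-(s / K))) ^ K := by
    rw [← Real.rpow_natCast, ← Real.rpow_mul hr0.le]
    congr 1
    field_simp
  calc (n : ℝ) ^ (-s)
      ≤ ((cellScale n : ℕ) : ℝ) ^ (-s) :=
        Real.rpow_le_rpow_of_nonpos hr0 hrn' (by linarith)
    _ = (((cellScale n : ℕ) : ℝ) ^ (-(s / K))) ^ K := hsplit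
    _ ≤ h (cellScale n) ^ K := pow_le_pow_left₀ hpow_nonneg hn K
    _ ≤ u n := pow_h_le_u hcov hhar h10

/-! ## The composition, by name -/

/-- **`SubpolynomialBlocking_of`**: the three registered stubs imply the crux
`Summit.CriticalPhenomena.PercolationContinuityZ3.Theses.PercNonProliferation.SubpolynomialBlocking`
(kernel-checked; no `sorry` outside the stubs). -/
theorem SubpolynomialBlocking_of (h1 : Registered.stub_shieldCover) (h2 : Registered.stub_harrisShields)
    (h3 : Registered.stub_wallPatchEnclosure) :
    Summit.CriticalPhenomena.PercolationContinuityZ3.Theses.PercNonProliferation.SubpolynomialBlocking :=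
  Negative.crux_iff.2 (subpolynomialBlockingAt_of h1 h2 h3)

/-- Wiring check: the registered stubs feed `SubpolynomialBlocking_of` as stated. -/
example : Summit.CriticalPhenomena.PercolationContinuityZ3.Theses.PercNonProliferation.SubpolynomialBlocking :=
  SubpolynomialBlocking_of stub_shieldCover stub_harrisShields stub_wallPatchEnclosure

/-! ## Readback against the landed Negative lane (examples, so `SubpolynomialBlocking_of` stays the only
named theorem concluding the crux) -/

/-- §2 honoured: the `(3, p)`-crux is FALSE for every `p > p_c(ℤ³)` (landed). STUBS 1–2 hold for every `p`, so
`C⁺` at such `p` is false too; the `p ≤ p_c` input belongs to STUB 3. -/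
example (p : unitInterval) (hp : criticalProb (zdGraph 3) (0 : Site 3) < p) :
    ¬ Negative.SubpolynomialBlockingAt 3 p :=
  Negative.not_subpolynomialBlockingAt_three_of_criticalProb_lt p hp

/-- §6 honoured: the uniform-in-`s` strengthening of the crux is refuted (landed); `C⁺` keeps `∀ s, ∀ᶠ r`. -/
example : ¬ ∃ N : ℕ, ∀ s : ℝ, 0 < s → ∀ n : ℕ, N ≤ n →
    (n : ℝ) ^ (-s) ≤ Negative.blockProb 3 (criticalProbI 3) n :=
  Negative.not_uniform_in_s

/-- §6 honoured: no "for all `n ≥ 1`" form (landed); the line's inequalities are eventual in `n`. -/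
example : ¬ ∀ s : ℝ, 0 < s → ∀ n : ℕ, 1 ≤ n → (n : ℝ) ^ (-s) ≤ Negative.blockProb 3 (criticalProbI 3) n :=
  Negative.not_forall_n

/-- The named fact behind "BGN for fixed `r`" is in tree (unproved, cited only; no stub leans on it). -/
example : Prop := BarskyGrimmettNewman1991_Z3

end Summit.CriticalPhenomena.PercolationContinuityZ3.Cruxes.SubpolynomialBlocking.RootTrickWallPatch

end
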